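import Summits.Ventures.HodgeRepro2.T5SU11JacobiPhaseLawAsymptotic
import Summits.Ventures.HodgeRepro2.T5SU11OrbitRadiusLaw

/-!
# All moments of the rescaled orbit radius are asymptotically exponential: `kⁿ E_{k,λ}|g·0|^{2n} → 2ⁿ n!`

Under `m_k φ_λ dν/m̂_k(λ)` the squared orbit radius is `|g·0|² = 1 − e^{−2s}`, `s = log|a|`
(`T5SU11OrbitRadiusLaw.norm_orbit_sq_eq`). In the phase variable, after `s = u/(k − 2)`,

  `(k − 2)^n ∫_G |g·0|^{2n} m_k φ_λ dν = (2π/(k − 2)) ∫_0^∞ ((k − 2)(1 − e^{−2u/(k−2)}))^n e^{−u} Φ_λ(u/(k − 2)) du`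

(`scaled_orbit_moment_eq`), and `(k − 2)(1 − e^{−2u/(k−2)}) ↑ 2u` (the derivative of `exp` at `0`; the bound
`1 − e^{−y} ≤ y`), so dominated convergence (`tendsto_scaled_orbit_integral`) gives

  **`kⁿ E_{k,λ}[|g·0|^{2n}] → 2ⁿ n!`**   (`tendsto_pow_mul_normalized_orbit_moment`)

for every real `λ` and every `n`: the rescaled orbit radius `k|g·0|²/2` converges in every moment to
`Exp(1)` — the moment companion of the limit law `T5SU11JacobiOrbitLawAsymptotic`; `n = 1` is
`T5SU11JacobiPhaseMGF.tendsto_mul_mean_orbit_sq`. Nothing is claimed about (N).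

Blind lane: Mathlib + the HodgeRepro2 prefix only; no sorry; axioms ⊆ {propext, Classical.choice,
Quot.sound}.
-/

namespace Summit.Ventures.HodgeRepro2.T5SU11JacobiOrbitMomentsAsymptotic

open MeasureTheory MeasureTheory.Measure Metric Set Filter Topology
open T5SU11Unimodular T5SU11Fibration T5SU11Cartan T5SU11OneParameter T5SU11CartanProjection T5HaarCircle
  T5BergmanCoefficient T5SU11FibrationHaar T5SU11SphericalFunction T5SU11SphericalSymmetry
  T5SU11SphericalBounds T5SU11SphericalContinuous T5SU11JacobiIwasawa T5SU11JacobiTransform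
  T5SU11JacobiWeight T5SU11KFiniteMajorantPow T5SU11JacobiWeightDeriv T5SU11PhaseLaw
  T5SU11PhaseLawLintegral T5SU11JacobiLaplacePhase T5SU11JacobiWeightAsymptotic T5SU11OrbitRadiusLaw
  T5SU11JacobiPhaseMomentsAsymptotic T5SU11JacobiPhaseLawAsymptotic
open scoped Real

/-! ### The elementary function `y ↦ 1 − e^{−y}` -/

/-- `1 − e^{−y} ≤ y` (for every real `y`). -/
theorem one_sub_exp_neg_le (y : ℝ) : 1 - Real.exp (-y) ≤ y := by
  have := Real.add_one_le_exp (-y)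
  linarith

/-- The algebra of the final rescaling: `kⁿ (I/m) = (k/a)ⁿ · (a^{n+1} I)/(a m)` for `a, m ≠ 0`. -/
theorem rescale_identity {a m : ℝ} (ha : a ≠ 0) (hm : m ≠ 0) (k I : ℝ) (n : ℕ) :
    k ^ n * (I / m) = (k / a) ^ n * ((a ^ (n + 1) * I) / (a * m)) := by
  rw [div_pow, pow_succ]
  field_simp

/-- `0 ≤ 1 − e^{−y}` for `y ≥ 0`. -/
theorem one_sub_exp_neg_nonneg {y : ℝ} (hy : 0 ≤ y) : 0 ≤ 1 - Real.exp (-y) := by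
  have : Real.exp (-y) ≤ 1 := Real.exp_le_one_iff.mpr (by linarith)
  linarith

/-- `(k − 2)(1 − e^{−2u/(k−2)}) → 2u` as `k → ∞`, for `u > 0` (the derivative of `exp` at `0`). -/
theorem tendsto_scaled_one_sub_exp {u : ℝ} (hu : 0 < u) :
    Tendsto (fun k : ℝ => (k - 2) * (1 - Real.exp (-(2 * u / (k - 2))))) atTop (𝓝 (2 * u)) := by
  -- `t⁻¹ (e^t − 1) → 1` as `t → 0`, `t ≠ 0`, composed with `t = −2u/(k − 2) → 0`
  have hd := (Real.hasDerivAt_exp 0).tendsto_slope_zero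
  simp only [Real.exp_zero, zero_add, smul_eq_mul] at hd
  have ht : Tendsto (fun k : ℝ => -(2 * u / (k - 2))) atTop (𝓝[≠] 0) := by
    refine tendsto_nhdsWithin_iff.mpr ⟨?_, ?_⟩
    · have := tendsto_sub_two_atTop.const_div_atTop (2 * u)
      simpa using this.neg
    · filter_upwards [eventually_gt_atTop (2 : ℝ)] with k hk
      simp only [mem_compl_iff, mem_singleton_iff, neg_eq_zero]
      exact div_ne_zero (by linarith) (by linarith)
  have h := (hd.comp ht).const_mul (2 * u)
  rw [mul_one] at h
  refine h.congr' ?_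
  filter_upwards [eventually_gt_atTop (2 : ℝ)] with k hk
  have hk2 : k - 2 ≠ 0 := by linarith
  simp only [Function.comp_apply]
  field_simp
  ring

section measure

variable [MeasurableSpace Circle] [BorelSpace Circle]

/-- `|g·0|^{2n} m_k φ_λ` is `ν`-integrable on the ray (`|g·0|² ≤ 1`). -/
theorem integrable_orbit_pow_mul {k lam : ℝ} (hk : 1 < k) (h1 : lam < k) (h2 : 2 < k + lam) (n : ℕ) :
    Integrable (fun g => (‖orbit g‖ ^ 2) ^ n * ((1 - ‖orbit g‖ ^ 2) ^ (k / 2) * sph lam g))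
      (nu haarCircle) := by
  refine (integrable_orbit_rpow_mul_sph hk h1 h2).mono' ?_ (Filter.Eventually.of_forall fun g => ?_)
  · exact ((continuous_norm.comp continuous_orbit).pow 2 |>.pow n).mul
      ((continuous_orbit_rpow k).mul (continuous_sph lam)) |>.aestronglyMeasurable
  · have h01 : ‖orbit g‖ ^ 2 ≤ 1 := by
      have := one_sub_norm_orbit_sq_pos g
      linarith
    have hp : 0 ≤ (1 - ‖orbit g‖ ^ 2) ^ (k / 2) * sph lam g :=
      mul_nonneg (orbit_rpow_nonneg k g) (sph_pos lam g).le
    rw [Real.norm_of_nonneg (mul_nonneg (pow_nonneg (sq_nonneg _) n) hp)]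
    exact mul_le_of_le_one_left hp (pow_le_one₀ (sq_nonneg _) h01)

/-- The orbit moments in the phase variable: on the ray,
`∫_G |g·0|^{2n} m_k φ_λ dν = 2π ∫_0^∞ (1 − e^{−2s})^n e^{−(k−2)s} Φ_λ(s) ds`. -/
theorem integral_orbit_pow_mul_eq_phase {k lam : ℝ} (hk : 1 < k) (h1 : lam < k) (h2 : 2 < k + lam)
    (n : ℕ) :
    ∫ g, (‖orbit g‖ ^ 2) ^ n * ((1 - ‖orbit g‖ ^ 2) ^ (k / 2) * sph lam g) ∂(nu haarCircle)
      = 2 * π * ∫ s in Ioi (0 : ℝ),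
          (1 - Real.exp (-(2 * s))) ^ n * Real.exp (-((k - 2) * s)) * sphPhase lam s := by
  have hF : Continuous fun s : ℝ => (1 - Real.exp (-(2 * s))) ^ n * Real.exp (-(k * s)) * sphPhase lam s :=
    (((continuous_const.sub (Real.continuous_exp.comp (continuous_const.mul continuous_id).neg)).pow n).mul
      (Real.continuous_exp.comp (continuous_const.mul continuous_id).neg)).mul (continuous_sphPhase lam)
  have hF0 : ∀ s, 0 ≤ s → 0 ≤ (1 - Real.exp (-(2 * s))) ^ n * Real.exp (-(k * s)) * sphPhase lam s :=
    fun s hs => mul_nonneg (mul_nonneg (pow_nonneg (one_sub_exp_neg_nonneg (by linarith)) n)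
      (Real.exp_pos _).le) (sphPhase_pos lam s).le
  have e : ∀ g : SU11, (‖orbit g‖ ^ 2) ^ n * ((1 - ‖orbit g‖ ^ 2) ^ (k / 2) * sph lam g)
      = (fun s : ℝ => (1 - Real.exp (-(2 * s))) ^ n * Real.exp (-(k * s)) * sphPhase lam s)
          (Real.log ‖mat g 0 0‖) := fun g => by
    simp only
    rw [orbit_rpow_eq_exp, sph_eq_sphPhase, norm_orbit_sq_eq, mul_assoc]
  have hint : Integrable (fun g => (fun s : ℝ => (1 - Real.exp (-(2 * s))) ^ n * Real.exp (-(k * s))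
      * sphPhase lam s) (Real.log ‖mat g 0 0‖)) (nu haarCircle) :=
    (integrable_orbit_pow_mul hk h1 h2 n).congr (Filter.Eventually.of_forall e)
  rw [integral_congr_ae (Filter.Eventually.of_forall e), integral_phase_eq hF hF0 hint]
  congr 1
  refine setIntegral_congr_fun measurableSet_Ioi fun s _ => ?_
  rw [show (1 - Real.exp (-(2 * s))) ^ n * Real.exp (-(k * s)) * sphPhase lam s * Real.exp (2 * s)
      = (1 - Real.exp (-(2 * s))) ^ n * (Real.exp (-(k * s)) * Real.exp (2 * s)) * sphPhase lam s by ring,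
    ← Real.exp_add]
  congr 3
  ring

omit [BorelSpace Circle] in
/-- **The scaled orbit moment after `s = u/(k − 2)`**: for `k > 2`,
`(k − 2)^{n+1} ∫_0^∞ (1 − e^{−2s})^n e^{−(k−2)s} Φ_λ(s) ds
  = ∫_0^∞ ((k − 2)(1 − e^{−2u/(k−2)}))^n e^{−u} Φ_λ(u/(k − 2)) du`. -/
theorem scaled_orbit_moment_eq (lam : ℝ) (n : ℕ) {k : ℝ} (hk : 2 < k) :
    (k - 2) ^ (n + 1) * ∫ s in Ioi (0 : ℝ),
        (1 - Real.exp (-(2 * s))) ^ n * Real.exp (-((k - 2) * s)) * sphPhase lam s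
      = ∫ u in Ioi (0 : ℝ), ((k - 2) * (1 - Real.exp (-(2 * u / (k - 2))))) ^ n * Real.exp (-u)
          * sphPhase lam (u / (k - 2)) := by
  have hc : 0 < k - 2 := by linarith
  have h := integral_comp_mul_left_Ioi (fun u : ℝ => ((k - 2) * (1 - Real.exp (-(2 * u / (k - 2))))) ^ n
    * Real.exp (-u) * sphPhase lam (u / (k - 2))) 0 hc
  rw [mul_zero, smul_eq_mul] at h
  have e : ∀ x : ℝ, (fun u : ℝ => ((k - 2) * (1 - Real.exp (-(2 * u / (k - 2))))) ^ n * Real.exp (-u)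
      * sphPhase lam (u / (k - 2))) ((k - 2) * x)
      = (k - 2) ^ n * ((1 - Real.exp (-(2 * x))) ^ n * Real.exp (-((k - 2) * x)) * sphPhase lam x) :=
    fun x => by
      simp only
      rw [mul_div_cancel_left₀ _ hc.ne', show 2 * ((k - 2) * x) / (k - 2) = 2 * x by
        field_simp, mul_pow]
      ring
  simp_rw [e] at h
  rw [integral_const_mul] at h
  have hc' : (k - 2) ≠ 0 := hc.ne'
  rw [pow_succ]
  calc (k - 2) ^ n * (k - 2) * ∫ s in Ioi (0 : ℝ),
          (1 - Real.exp (-(2 * s))) ^ n * Real.exp (-((k - 2) * s)) * sphPhase lam s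
      = (k - 2) * ((k - 2) ^ n * ∫ s in Ioi (0 : ℝ),
          (1 - Real.exp (-(2 * s))) ^ n * Real.exp (-((k - 2) * s)) * sphPhase lam s) := by ring
    _ = (k - 2) * ((k - 2)⁻¹ * ∫ u in Ioi (0 : ℝ),
          ((k - 2) * (1 - Real.exp (-(2 * u / (k - 2))))) ^ n * Real.exp (-u)
            * sphPhase lam (u / (k - 2))) := by rw [h]
    _ = _ := by rw [← mul_assoc, mul_inv_cancel₀ hc', one_mul]

/-- **Dominated convergence**: `∫_0^∞ ((k − 2)(1 − e^{−2u/(k−2)}))^n e^{−u} Φ_λ(u/(k − 2)) du → 2ⁿ n!`. -/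
theorem tendsto_scaled_orbit_integral (lam : ℝ) (n : ℕ) :
    Tendsto (fun k : ℝ => ∫ u in Ioi (0 : ℝ), ((k - 2) * (1 - Real.exp (-(2 * u / (k - 2))))) ^ n
        * Real.exp (-u) * sphPhase lam (u / (k - 2))) atTop (𝓝 (2 ^ n * (n.factorial : ℝ))) := by
  set C : ℝ := Real.exp (|lam - 1| * Real.log 2) with hC
  have hlim := tendsto_integral_filter_of_dominated_convergence (μ := volume.restrict (Ioi (0 : ℝ)))
    (l := atTop)
    (F := fun k u => ((k - 2) * (1 - Real.exp (-(2 * u / (k - 2))))) ^ n * Real.exp (-u)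
      * sphPhase lam (u / (k - 2)))
    (f := fun u => (2 * u) ^ n * Real.exp (-u)) (fun u => C * 2 ^ n * (u ^ n * Real.exp (-(u / 2))))
    (Filter.Eventually.of_forall fun k => ?_) ?_
    ((integrableOn_pow_mul_exp_neg_half_Ioi n).const_mul (C * 2 ^ n)) ?_
  · have e : ∫ u in Ioi (0 : ℝ), (2 * u) ^ n * Real.exp (-u) = 2 ^ n * (n.factorial : ℝ) := by
      simp_rw [mul_pow, mul_assoc]
      rw [integral_const_mul, integral_pow_mul_exp_neg_Ioi n]
    rwa [e] at hlim
  · exact (((((continuous_const.sub (Real.continuous_exp.comp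
      ((continuous_const.mul continuous_id).div_const _).neg)).const_mul _).pow n).mul
      (Real.continuous_exp.comp continuous_neg)).mul
      ((continuous_sphPhase lam).comp (continuous_id.div_const _))).aestronglyMeasurable
  · filter_upwards [eventually_gt_atTop (2 + 2 * |lam - 1|)] with k hk
    filter_upwards [ae_restrict_mem measurableSet_Ioi] with u hu
    rw [mem_Ioi] at hu
    have hk2 : 0 < k - 2 := by linarith [abs_nonneg (lam - 1)]
    have hΦ : sphPhase lam (u / (k - 2)) ≤ C * Real.exp (u / 2) := by
      refine (sphPhase_le_exp lam (div_nonneg hu.le hk2.le)).trans ?_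
      refine mul_le_mul_of_nonneg_left (Real.exp_le_exp.mpr ?_) (Real.exp_pos _).le
      rw [mul_div_assoc', div_le_div_iff₀ hk2 two_pos]
      nlinarith [abs_nonneg (lam - 1)]
    have hy : 0 ≤ 2 * u / (k - 2) := by positivity
    have hb0 : 0 ≤ (k - 2) * (1 - Real.exp (-(2 * u / (k - 2)))) :=
      mul_nonneg hk2.le (one_sub_exp_neg_nonneg hy)
    have hb : (k - 2) * (1 - Real.exp (-(2 * u / (k - 2)))) ≤ 2 * u := by
      have := one_sub_exp_neg_le (2 * u / (k - 2))
      calc (k - 2) * (1 - Real.exp (-(2 * u / (k - 2)))) ≤ (k - 2) * (2 * u / (k - 2)) := by gcongr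
        _ = 2 * u := by field_simp
    have hnn : 0 ≤ ((k - 2) * (1 - Real.exp (-(2 * u / (k - 2))))) ^ n * Real.exp (-u)
        * sphPhase lam (u / (k - 2)) :=
      mul_nonneg (mul_nonneg (pow_nonneg hb0 n) (Real.exp_pos _).le) (sphPhase_pos lam _).le
    rw [Real.norm_of_nonneg hnn]
    calc ((k - 2) * (1 - Real.exp (-(2 * u / (k - 2))))) ^ n * Real.exp (-u) * sphPhase lam (u / (k - 2))
        ≤ (2 * u) ^ n * Real.exp (-u) * (C * Real.exp (u / 2)) :=
          mul_le_mul (mul_le_mul_of_nonneg_right (pow_le_pow_left₀ hb0 hb n) (Real.exp_pos _).le) hΦ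
            (sphPhase_pos lam _).le (by positivity)
      _ = C * 2 ^ n * (u ^ n * (Real.exp (-u) * Real.exp (u / 2))) := by ring
      _ = C * 2 ^ n * (u ^ n * Real.exp (-(u / 2))) := by
          rw [← Real.exp_add]
          congr 3
          ring
  · filter_upwards [ae_restrict_mem measurableSet_Ioi] with u hu
    rw [mem_Ioi] at hu
    have hdiv : Tendsto (fun k : ℝ => u / (k - 2)) atTop (𝓝 0) :=
      tendsto_sub_two_atTop.const_div_atTop u
    have hΦ : Tendsto (fun k : ℝ => sphPhase lam (u / (k - 2))) atTop (𝓝 (sphPhase lam 0)) :=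
      ((continuous_sphPhase lam).tendsto 0).comp hdiv
    rw [sphPhase_zero] at hΦ
    have h1 := ((tendsto_scaled_one_sub_exp hu).pow n).mul_const (Real.exp (-u))
    simpa using h1.mul hΦ

/-! ### The moments on `G` -/

/-- **`(k − 2)ⁿ ∫_G |g·0|^{2n} m_k φ_λ dν · (k − 2)/(2π) → 2ⁿ n!`**, i.e.
`(k − 2)^{n+1} ∫_G |g·0|^{2n} m_k φ_λ dν → 2π 2ⁿ n!` as `k → ∞`, for every `λ`. -/
theorem tendsto_scaled_orbit_moment (lam : ℝ) (n : ℕ) :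
    Tendsto (fun k : ℝ => (k - 2) ^ (n + 1)
        * ∫ g, (‖orbit g‖ ^ 2) ^ n * ((1 - ‖orbit g‖ ^ 2) ^ (k / 2) * sph lam g) ∂(nu haarCircle))
      atTop (𝓝 (2 * π * (2 ^ n * (n.factorial : ℝ)))) := by
  have h := (tendsto_scaled_orbit_integral lam n).const_mul (2 * π)
  refine h.congr' ?_
  filter_upwards [eventually_gt_atTop (max 2 (max lam (2 - lam)))] with k hk
  rw [max_lt_iff, max_lt_iff] at hk
  rw [integral_orbit_pow_mul_eq_phase (by linarith) (by linarith) (by linarith) n,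
    ← scaled_orbit_moment_eq lam n hk.1]
  ring

/-- **ALL MOMENTS OF THE RESCALED ORBIT RADIUS ARE ASYMPTOTICALLY THOSE OF `Exp(1)`**: for every `λ`,
`kⁿ E_{k,λ}[|g·0|^{2n}] → 2ⁿ n!` as `k → ∞`. -/
theorem tendsto_pow_mul_normalized_orbit_moment (lam : ℝ) (n : ℕ) :
    Tendsto (fun k : ℝ => k ^ n
        * ((∫ g, (‖orbit g‖ ^ 2) ^ n * ((1 - ‖orbit g‖ ^ 2) ^ (k / 2) * sph lam g) ∂(nu haarCircle))
          / ∫ g, (1 - ‖orbit g‖ ^ 2) ^ (k / 2) * sph lam g ∂(nu haarCircle)))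
      atTop (𝓝 (2 ^ n * (n.factorial : ℝ))) := by
  have hpi : (2 * π : ℝ) ≠ 0 := by positivity
  have hA := (tendsto_scaled_orbit_moment lam n).div (tendsto_sub_two_mul_jacobi_weight lam) hpi
  rw [show 2 * π * (2 ^ n * (n.factorial : ℝ)) / (2 * π) = 2 ^ n * (n.factorial : ℝ) by field_simp] at hA
  have h1 : Tendsto (fun k : ℝ => k / (k - 2)) atTop (𝓝 1) := by
    simpa using tendsto_div_sub_two_pow 0
  have h := (h1.pow n).mul hA
  rw [one_pow, one_mul] at h
  refine h.congr' ?_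
  filter_upwards [eventually_gt_atTop (max 2 (max lam (2 - lam)))] with k hk
  rw [max_lt_iff, max_lt_iff] at hk
  have hk2 : k - 2 ≠ 0 := by linarith
  have hm : ∫ g, (1 - ‖orbit g‖ ^ 2) ^ (k / 2) * sph lam g ∂(nu haarCircle) ≠ 0 :=
    (jacobi_pos (by linarith) (by linarith) (by linarith)).ne'
  simp only [Pi.div_apply]
  exact (rescale_identity hk2 hm k _ n).symm

end measure

end Summit.Ventures.HodgeRepro2.T5SU11JacobiOrbitMomentsAsymptotic
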